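import Summits.QuantumFields.YangMills.Theorems.BalabanUVNodesN21ChartExponentConvexity
import Summits.QuantumFields.YangMills.Theorems.BalabanUVNodesN21LowCentreEndAtSUNBlockChart

/-!
# N21 (NE7c) · CONVEXITY OF THE [LF-II] (1.2) EXPONENT ON THE EXPONENTIAL `SU(N)` BLOCK CHART: the binder `hφ` of
# dag-n21-w1's END on pub-balaban's `BlockChartSU N b` DISCHARGED in printed-row form (file 2 of WIDTH-209 N21 piece 2)

Width seat pub-ymgap-dag-n21-w3 (g3; director-ym №197 ∕ HUMAN RULING D-0149; dag-lead WIDTH-209 l.28628, N21 piece 2 =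
dag-n21-w1's resume trigger (t4) «CONVEXITY of the [LF-II] (1.2) exponent on the SU(N) exponential block chart ⇒ the
printed-row form of `hK ∕ hφ`»), node N21 = NE7c (single-run shell-weight bound, NOT PRINTED in [Bałaban 1983–89], NOT
proved), lane K3⁷ `SpineGivenEndpointR13SepCoPH` (stmt-QuantumFields-20544, `--kind proof --supports … --as helper`).
Second file of the piece: file 1 (p606637 `…N21ChartExponentConvexity`) typed the discharge in the flat block frame
`κ → ℝ` and knit it into dag-n21-w1's ★★★ p590709 ∕ ★★★★ p592783; this file reads it on pub-balaban's block chart space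
`BlockChartSU N b = ↥b → E_N` (`E_N = EuclideanSpace ℝ (Fin d_N)`), the frame of dag-n21-w1 g2's ★★★
`N21LowCentreEndAtSUNBlockChart.slotAntiConcentration_blockChartSU_of_sect1Letters` (p604008) and of dag-n21-w2's
JUNCTION №3 `hchart`, and knits it there BY NAME.

WHAT.  §0 [folklore] the flat coordinates `z ↦ (q ↦ z q.1 q.2)` of the block chart space: additive, homogeneous, and
`1`-Lipschitz for the sup norms (`‖flat z‖ ≤ ‖z‖`, since `|z_{b′,a}| ≤ ‖z b′‖_{E_N}`); `‖z‖² ≤ Σ_{b′} ‖z b′‖²`.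
§1 ★ `convexOn_blockChartSU_expansion_of_quadraticRemainder`: on a convex `K ⊆ BlockChartSU N b` with
`φ v = c + ½·Qf v + lin v + Vt v`, `Qf v = flat v ⬝ᵥ (A *ᵥ flat v)` for a real matrix `A` on `↥b × Fin d_N` (print's
«leading quadratic form» in bond ⊗ colour coordinates), (1.9) `Ineq19 (Qf v) (Σ_{b′} ‖v b′‖²) γ₀ d M` for every `v`,
`lin = ⇑ℓ`, and a quadratic-remainder letter `|Vt y − Vt x − L_x(y − x)| ≤ Mq‖y − x‖²` (block chart norm) ⇒
`ConvexOn ℝ K φ` under `4·d·(100M)^{d+1}·Mq ≤ γ₀`.  §2 ★★ `convexOn_blockChartSU_expansion_of_analyticRemainder`: the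
letter `Mq = 2B∕r²` SUPPLIED by the Cauchy rung (dag-n21-w3 g0 p591155 §3) in the flat complex coordinates
`↥b × Fin d_N → ℂ`: `Vt = Re Φ ∘ ι ∘ flat` with `Φ` complex differentiable on the `r`-balls about the real points
`ι(flat x)`, `x ∈ K`, oscillation `≤ B`, `diam K < r` ⇒ `ConvexOn` under `8·d·(100M)^{d+1}·B ≤ γ₀·r²`.  §2b ★★′
(both frames): the oscillation letter from a VALUE row `‖Φ‖ ≤ S` on the complex `r`-balls — print's shape ([LF-II] p. 357,
[B13] (1.36)) — so `B = 2S` and the clause reads `16·d·(100M)^{d+1}·S ≤ γ₀·r²`; no second-order row is needed.  §3 ★★★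
`slotAntiConcentration_blockChartSU_of_sect1Letters_convexFree` = p604008's ★★★ with `hφ` DISCHARGED by §2 (every other
binder verbatim; `h19` asked for every `v`, as printed).

HONEST FRAMING.  [folklore] coordinates + [textbook] convex analysis + file 1 ∕ the Cauchy rung ∕ p604008 BY NAME; 0 def,
0 sorry.  The identification of (`A`, `ℓ`, `Φ`, `r`, `B`) with the members of [LF-II] (1.2) ∕ [B13] Lemma 2 is LOCATED
typing, NOT asserted; `hK` (convexity of the kept cut) stays displayed; nothing of Bałaban's asserted; (M1) ∕ NE7c NOT
PRINTED ∕ NOT proved; N21 NOT discharged; K3⁷ NOT claimed; counts unmoved (typed 28∕28 · discharged 5∕27); count-neutral;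
one finite 𝕋⁴ at fixed ε — the Yang–Mills mass gap (Clay) is NOT proved by any of this: R4 closes the conditional
finite-𝕋⁴ rung `BalabanLadder.UV` only; nothing continuum ∕ ℝ⁴ ∕ OS.
-/

set_option autoImplicit false

noncomputable section

open MeasureTheory Set Function Finset Matrix Metric
open scoped ENNReal

namespace Summit.QuantumFields.YangMills.Theorems.N21ChartExponentConvexitySUN

open Literature.MathematicalPhysics.QuantumFieldTheory.Balaban1983to89
open Literature.MathematicalPhysics.QuantumFieldTheory.Balaban1983to89.T4ShellMeasure (SlotAntiConcentration)
open Literature.MathematicalPhysics.QuantumFieldTheory.Balaban1983to89.B16Sect1Wilson (Ineq16 Ineq19)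
open Summit.QuantumFields.BalabanUV.T4Continuum.ShellMeasureExpChartSUN (ChartSU BlockChartSU dimSU dimSU_eq)
open Summit.QuantumFields.YangMills.Theorems.N21ChartExponentConvexity
  (convexOn_of_affine_minorant quadForm_sub_sub_cross cross_linear)
open Summit.QuantumFields.YangMills.Theorems.N21AnalyticResponseRemainder
  (quadraticRemainder_pi_real_of_differentiableOn_ball)
open Summit.QuantumFields.YangMills.Theorems.N21LowCentreEndAtSUNBlockChart
  (slotAntiConcentration_blockChartSU_of_sect1Letters)

variable {N : ℕ} {P : Params} {j : ℕ}

/-! ## §0  The flat coordinates of the block chart space -/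

section Flat

/-- flat coordinates are additive. [folklore] -/
theorem flat_add (b : Finset (PBond P j)) (v w : BlockChartSU N b) :
    (fun q : ↥b × Fin (dimSU N) => (v + w) q.1 q.2) =
      (fun q : ↥b × Fin (dimSU N) => v q.1 q.2) + fun q => w q.1 q.2 := by
  funext q
  simp

/-- flat coordinates are homogeneous. [folklore] -/
theorem flat_smul (b : Finset (PBond P j)) (a : ℝ) (v : BlockChartSU N b) :
    (fun q : ↥b × Fin (dimSU N) => (a • v) q.1 q.2) = a • fun q : ↥b × Fin (dimSU N) => v q.1 q.2 := by
  funext q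
  simp

/-- flat coordinates respect differences. [folklore] -/
theorem flat_sub (b : Finset (PBond P j)) (v w : BlockChartSU N b) :
    (fun q : ↥b × Fin (dimSU N) => (v - w) q.1 q.2) =
      (fun q : ↥b × Fin (dimSU N) => v q.1 q.2) - fun q => w q.1 q.2 := by
  funext q
  simp

/-- the sup norm of the flat coordinates is at most the block chart norm (`|z_{b′,a}| ≤ ‖z b′‖_{E_N} ≤ ‖z‖`). [folklore] -/
theorem norm_flat_le (b : Finset (PBond P j)) (z : BlockChartSU N b) :
    ‖(fun q : ↥b × Fin (dimSU N) => z q.1 q.2)‖ ≤ ‖z‖ := by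
  refine (pi_norm_le_iff_of_nonneg (norm_nonneg z)).2 fun q => ?_
  exact (PiLp.norm_apply_le (z q.1) q.2).trans (norm_le_pi_norm z q.1)

/-- `‖z‖² ≤ Σ_{b′} ‖z b′‖²` on the block chart space (sup over bonds vs sum over bonds). [folklore] -/
theorem sq_norm_le_sum_sq_norm (b : Finset (PBond P j)) (z : BlockChartSU N b) : ‖z‖ ^ 2 ≤ ∑ i, ‖z i‖ ^ 2 := by
  have hS : 0 ≤ ∑ i, ‖z i‖ ^ 2 := Finset.sum_nonneg fun i _ => sq_nonneg _
  have h1 : ‖z‖ ≤ Real.sqrt (∑ i, ‖z i‖ ^ 2) := by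
    refine (pi_norm_le_iff_of_nonneg (Real.sqrt_nonneg _)).2 fun i => ?_
    have h := Real.abs_le_sqrt (Finset.single_le_sum (f := fun i' => ‖z i'‖ ^ 2) (fun i' _ => sq_nonneg _)
      (Finset.mem_univ i))
    rwa [abs_of_nonneg (norm_nonneg _)] at h
  calc ‖z‖ ^ 2 ≤ Real.sqrt (∑ i, ‖z i‖ ^ 2) ^ 2 := pow_le_pow_left₀ (norm_nonneg _) h1 2
    _ = ∑ i, ‖z i‖ ^ 2 := Real.sq_sqrt hS

end Flat

/-! ## §1  ★ Convexity on the block chart space from a quadratic-remainder letter -/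

section QuadraticRemainder

/-- ★ **CONVEXITY OF THE (1.2) EXPONENT ON `BlockChartSU N b` FROM (1.9) + STRUCTURE + A QUADRATIC-REMAINDER LETTER + ONE
CLAUSE.**  File 1's ★ read on the block chart space: `Qf v = flat v ⬝ᵥ (A *ᵥ flat v)` (a quadratic form in the bond ⊗
colour coordinates; no symmetry used), (1.9) `Ineq19 (Qf v) (Σ_{b′} ‖v b′‖²) γ₀ d M` for every `v`, `lin = ⇑ℓ`, the
letter `|Vt y − Vt x − L_x(y − x)| ≤ Mq·‖y − x‖²` in the block chart norm, clause `4·d·(100M)^{d+1}·Mq ≤ γ₀`.  Proof: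
affine minorant `½(flat x ⬝A flat · + flat · ⬝A flat x) + ℓ + L_x`; defect `≥ ½λΣ_{b′}‖(y−x) b′‖² − Mq‖y−x‖² ≥ 0` by
`‖y−x‖² ≤ Σ_{b′}‖(y−x) b′‖²`. [textbook] -/
theorem convexOn_blockChartSU_expansion_of_quadraticRemainder (b : Finset (PBond P j)) {K : Set (BlockChartSU N b)}
    (hK : Convex ℝ K) (φ Qf lin Vt : BlockChartSU N b → ℝ) (c : ℝ)
    (hexp : ∀ v ∈ K, φ v = c + 1 / 2 * Qf v + lin v + Vt v)
    (A : Matrix (↥b × Fin (dimSU N)) (↥b × Fin (dimSU N)) ℝ)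
    (hQf : ∀ v, Qf v = (fun q : ↥b × Fin (dimSU N) => v q.1 q.2) ⬝ᵥ (A *ᵥ fun q => v q.1 q.2))
    {γ₀ M : ℝ} {d : ℕ} (hd : 1 ≤ d) (hM : 0 < M) (hγ₀ : 0 < γ₀)
    (h19 : ∀ v, Ineq19 (Qf v) (∑ i, ‖v i‖ ^ 2) γ₀ d M)
    (ℓ : BlockChartSU N b →ₗ[ℝ] ℝ) (hlin : ∀ v, lin v = ℓ v)
    (L : BlockChartSU N b → BlockChartSU N b →ₗ[ℝ] ℝ) {Mq : ℝ}
    (hVt : ∀ x ∈ K, ∀ y ∈ K, |Vt y - Vt x - L x (y - x)| ≤ Mq * ‖y - x‖ ^ 2)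
    (hclause : 4 * d * (100 * M) ^ (d + 1) * Mq ≤ γ₀) :
    ConvexOn ℝ K φ := by
  have hd0 : (0 : ℝ) < d := by exact_mod_cast hd
  set D : ℝ := 2 * d * (100 * M) ^ (d + 1) with hD
  have hDpos : 0 < D := by positivity
  have hMq : Mq ≤ γ₀ / (2 * D) := by
    rw [le_div_iff₀ (by positivity)]
    calc Mq * (2 * D) = 4 * d * (100 * M) ^ (d + 1) * Mq := by rw [hD]; ring
      _ ≤ γ₀ := hclause
  -- flat coordinates
  set fl : BlockChartSU N b → (↥b × Fin (dimSU N) → ℝ) := fun z q => z q.1 q.2 with hfl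
  have hfl_add : ∀ v w, fl (v + w) = fl v + fl w := fun v w => flat_add b v w
  have hfl_smul : ∀ (a : ℝ) v, fl (a • v) = a • fl v := fun a v => flat_smul b a v
  have hfl_sub : ∀ v w, fl (v - w) = fl v - fl w := fun v w => flat_sub b v w
  refine convexOn_of_affine_minorant hK
    (fun x w => 1 / 2 * (fl x ⬝ᵥ (A *ᵥ fl w) + fl w ⬝ᵥ (A *ᵥ fl x)) + ℓ w + L x w) ?_ ?_
  · intro z _ u v a a'
    rw [hfl_add, hfl_smul, hfl_smul, cross_linear, map_add, map_smul, map_smul, map_add, map_smul, map_smul]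
    simp only [smul_eq_mul]
    ring
  · intro x hx y hy
    have hq : γ₀ / D * ∑ i, ‖(y - x) i‖ ^ 2 ≤ fl (y - x) ⬝ᵥ (A *ᵥ fl (y - x)) := by
      have := h19 (y - x)
      unfold Ineq19 at this
      rw [hQf, ← hD] at this
      exact this
    have hQfx : Qf x = fl x ⬝ᵥ (A *ᵥ fl x) := hQf x
    have hQfy : Qf y = fl y ⬝ᵥ (A *ᵥ fl y) := hQf y
    have hpol : fl y ⬝ᵥ (A *ᵥ fl y) - fl x ⬝ᵥ (A *ᵥ fl x)
        - (fl x ⬝ᵥ (A *ᵥ (fl y - fl x)) + (fl y - fl x) ⬝ᵥ (A *ᵥ fl x)) = fl (y - x) ⬝ᵥ (A *ᵥ fl (y - x)) := by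
      rw [hfl_sub]; exact quadForm_sub_sub_cross A (fl x) (fl y)
    have hrem : -(Mq * ‖y - x‖ ^ 2) ≤ Vt y - Vt x - L x (y - x) := (abs_le.1 (hVt x hx y hy)).1
    have hsq := sq_norm_le_sum_sq_norm b (y - x)
    have hS : 0 ≤ ∑ i, ‖(y - x) i‖ ^ 2 := Finset.sum_nonneg fun i _ => sq_nonneg _
    have hdom : Mq * ‖y - x‖ ^ 2 ≤ γ₀ / (2 * D) * ∑ i, ‖(y - x) i‖ ^ 2 := by
      rcases le_or_gt Mq 0 with hneg | hpos
      · calc Mq * ‖y - x‖ ^ 2 ≤ 0 := mul_nonpos_of_nonpos_of_nonneg hneg (sq_nonneg _)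
          _ ≤ γ₀ / (2 * D) * ∑ i, ‖(y - x) i‖ ^ 2 := mul_nonneg (by positivity) hS
      · calc Mq * ‖y - x‖ ^ 2 ≤ Mq * ∑ i, ‖(y - x) i‖ ^ 2 := mul_le_mul_of_nonneg_left hsq hpos.le
          _ ≤ γ₀ / (2 * D) * ∑ i, ‖(y - x) i‖ ^ 2 := mul_le_mul_of_nonneg_right hMq hS
    have hhalf : γ₀ / (2 * D) * ∑ i, ‖(y - x) i‖ ^ 2 = 1 / 2 * (γ₀ / D * ∑ i, ‖(y - x) i‖ ^ 2) := by
      field_simp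
    have hflyx : fl y - fl x = fl (y - x) := (hfl_sub y x).symm
    rw [hflyx] at hpol
    rw [hexp x hx, hexp y hy, hQfx, hQfy, hlin x, hlin y, map_sub]
    nlinarith [hq, hpol, hrem, hdom, hhalf]

end QuadraticRemainder

/-! ## §2  ★★ The letter from the Cauchy rung in the flat complex coordinates -/

section AnalyticRemainder

/-- ★★ **CONVEXITY OF THE (1.2) EXPONENT ON `BlockChartSU N b` WITH AN ANALYTIC REMAINDER.**  ★ with `Mq = 2B∕r²`
SUPPLIED by the Cauchy rung (p591155 §3) in the flat complex coordinates `↥b × Fin d_N → ℂ`: `Vt x = Re Φ(ι(flat x))`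
on `K`, `Φ` complex differentiable on `ball (ι(flat x)) r` with `Φ(ball) ⊆ closedBall (Φ(ι(flat x))) B` for `x ∈ K`,
and `diam K < r` in the block chart norm (so `< r` in the flat sup norm, §0); clause `8·d·(100M)^{d+1}·B ≤ γ₀·r²`
(«for g_k sufficiently small»; the letters are [B13] Lemma 2-shaped, LOCATED, not asserted). [textbook] -/
theorem convexOn_blockChartSU_expansion_of_analyticRemainder (b : Finset (PBond P j)) {K : Set (BlockChartSU N b)}
    (hK : Convex ℝ K) (φ Qf lin Vt : BlockChartSU N b → ℝ) (c : ℝ)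
    (hexp : ∀ v ∈ K, φ v = c + 1 / 2 * Qf v + lin v + Vt v)
    (A : Matrix (↥b × Fin (dimSU N)) (↥b × Fin (dimSU N)) ℝ)
    (hQf : ∀ v, Qf v = (fun q : ↥b × Fin (dimSU N) => v q.1 q.2) ⬝ᵥ (A *ᵥ fun q => v q.1 q.2))
    {γ₀ M : ℝ} {d : ℕ} (hd : 1 ≤ d) (hM : 0 < M) (hγ₀ : 0 < γ₀)
    (h19 : ∀ v, Ineq19 (Qf v) (∑ i, ‖v i‖ ^ 2) γ₀ d M)
    (ℓ : BlockChartSU N b →ₗ[ℝ] ℝ) (hlin : ∀ v, lin v = ℓ v)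
    (Φ : (↥b × Fin (dimSU N) → ℂ) → ℂ) {r B : ℝ}
    (hVt : ∀ x ∈ K, Vt x = (Φ fun q => ((x q.1 q.2 : ℝ) : ℂ)).re)
    (hΦd : ∀ x ∈ K, DifferentiableOn ℂ Φ (ball (fun q => ((x q.1 q.2 : ℝ) : ℂ)) r))
    (hΦB : ∀ x ∈ K, MapsTo Φ (ball (fun q => ((x q.1 q.2 : ℝ) : ℂ)) r)
      (closedBall (Φ fun q => ((x q.1 q.2 : ℝ) : ℂ)) B))
    (hdiam : ∀ x ∈ K, ∀ y ∈ K, ‖y - x‖ < r)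
    (hclause : 8 * d * (100 * M) ^ (d + 1) * B ≤ γ₀ * r ^ 2) :
    ConvexOn ℝ K φ := by
  -- flat coordinates, as a linear map
  set fl : BlockChartSU N b → (↥b × Fin (dimSU N) → ℝ) := fun z q => z q.1 q.2 with hfl
  have hfl_sub : ∀ v w, fl (v - w) = fl v - fl w := fun v w => flat_sub b v w
  let flₗ : BlockChartSU N b →ₗ[ℝ] (↥b × Fin (dimSU N) → ℝ) :=
    { toFun := fl
      map_add' := fun v w => flat_add b v w
      map_smul' := fun a v => flat_smul b a v }
  -- the Cauchy rung on the flat image of `K`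
  have hd' : ∀ x' ∈ fl '' K, DifferentiableOn ℂ Φ (ball (fun q => (x' q : ℂ)) r) := by
    rintro _ ⟨x, hx, rfl⟩; exact hΦd x hx
  have hB' : ∀ x' ∈ fl '' K, MapsTo Φ (ball (fun q => (x' q : ℂ)) r) (closedBall (Φ fun q => (x' q : ℂ)) B) := by
    rintro _ ⟨x, hx, rfl⟩; exact hΦB x hx
  have hdiam' : ∀ x' ∈ fl '' K, ∀ y' ∈ fl '' K, ‖y' - x'‖ < r := by
    rintro _ ⟨x, hx, rfl⟩ _ ⟨y, hy, rfl⟩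
    rw [← hfl_sub]
    exact (norm_flat_le b (y - x)).trans_lt (hdiam x hx y hy)
  obtain ⟨Lc, hLc⟩ := quadraticRemainder_pi_real_of_differentiableOn_ball Φ hd' hB' hdiam'
  refine convexOn_blockChartSU_expansion_of_quadraticRemainder b hK φ Qf lin Vt c hexp A hQf hd hM hγ₀ h19 ℓ hlin
    (fun x => (Complex.reLm.comp (Lc (fl x))).comp flₗ) (Mq := 2 * B / r ^ 2) ?_ ?_
  · intro x hx y hy
    have h := hLc (fl x) ⟨x, hx, rfl⟩ (fl y) ⟨y, hy, rfl⟩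
    -- the constant `2B∕r²` is nonnegative as soon as `K` has a point (`0 < r`, and `Φ(centre) ∈ closedBall _ B`)
    have hr2 : 0 ≤ 2 * B / r ^ 2 := by
      have hr : 0 < r := by simpa using hdiam x hx x hx
      have hBx := hB' (fl x) ⟨x, hx, rfl⟩ (mem_ball_self hr)
      rw [mem_closedBall, dist_self] at hBx
      positivity
    have hre : Vt y - Vt x - ((Complex.reLm.comp (Lc (fl x))).comp flₗ) (y - x) =
        (Φ (fun q => ((fl y) q : ℂ)) - Φ (fun q => ((fl x) q : ℂ)) - Lc (fl x) (fl y - fl x)).re := by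
      rw [hVt x hx, hVt y hy, LinearMap.comp_apply, LinearMap.comp_apply, Complex.reLm_coe, Complex.sub_re,
        Complex.sub_re]
      congr 2
    rw [hre]
    refine ((Complex.abs_re_le_norm _).trans h).trans ?_
    rw [← hfl_sub]
    exact mul_le_mul_of_nonneg_left (pow_le_pow_left₀ (norm_nonneg _) (norm_flat_le b (y - x)) 2) hr2
  · -- the clause at `Mq = 2B∕r²`
    rcases eq_or_ne r 0 with hr | hr
    · subst hr
      simp only [ne_eq, OfNat.ofNat_ne_zero, not_false_eq_true, zero_pow, div_zero, mul_zero]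
      exact hγ₀.le
    · have hr2 : 0 < r ^ 2 := by positivity
      rw [show 4 * (d : ℝ) * (100 * M) ^ (d + 1) * (2 * B / r ^ 2) = 8 * d * (100 * M) ^ (d + 1) * B / r ^ 2 by ring,
        div_le_iff₀ hr2]
      exact hclause

/-! ### §2b  The oscillation letter from a VALUE row on the complex neighbourhood (print's shape) -/

/-- **OSCILLATION FROM A SUP BOUND**: if `‖Φ u‖ ≤ S` on `ball c r` with `0 < r`, then `Φ(ball c r) ⊆ closedBall (Φ c) (2S)`.
Print's bounds on the remainder are VALUE bounds on a COMPLEX neighbourhood ([LF-II] p. 357 «estimated by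
O(g_k^{1−β})∣Λ∣»; [B13] (1.36) on the space (1.34)) — this is the only step between that shape and the Cauchy letter `B`.
[textbook] -/
theorem mapsTo_closedBall_of_norm_le {W E : Type*} [PseudoMetricSpace W] [SeminormedAddCommGroup E] (Φ : W → E)
    {c : W} {r S : ℝ} (hr : 0 < r) (hS : ∀ u ∈ ball c r, ‖Φ u‖ ≤ S) :
    MapsTo Φ (ball c r) (closedBall (Φ c) (2 * S)) := by
  intro u hu
  rw [mem_closedBall, dist_eq_norm]
  calc ‖Φ u - Φ c‖ ≤ ‖Φ u‖ + ‖Φ c‖ := norm_sub_le _ _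
    _ ≤ S + S := add_le_add (hS u hu) (hS c (mem_ball_self hr))
    _ = 2 * S := by ring

/-- ★★′ **CONVEXITY OF THE (1.2) EXPONENT ON `BlockChartSU N b` FROM A VALUE ROW ON THE COMPLEX NEIGHBOURHOOD.**  ★★ with
the oscillation letter SUPPLIED by a sup bound `‖Φ u‖ ≤ S` on the `r`-balls about the real points of `K` (§2b, `B = 2S`):
no second-order row is needed — analyticity + the printed-shape VALUE bound on the complex chart + the clause
`16·d·(100M)^{d+1}·S ≤ γ₀·r²` give `ConvexOn ℝ K φ`.  (LOCATED: `S` ↔ «O(g_k^{1−β})∣Λ∣», `r` ↔ the complex width of the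
chart `{|B′| < M₀g_k⁻¹ε_k}`; NOT asserted.) [textbook] -/
theorem convexOn_blockChartSU_expansion_of_analyticSupBound (b : Finset (PBond P j)) {K : Set (BlockChartSU N b)}
    (hK : Convex ℝ K) (φ Qf lin Vt : BlockChartSU N b → ℝ) (c : ℝ)
    (hexp : ∀ v ∈ K, φ v = c + 1 / 2 * Qf v + lin v + Vt v)
    (A : Matrix (↥b × Fin (dimSU N)) (↥b × Fin (dimSU N)) ℝ)
    (hQf : ∀ v, Qf v = (fun q : ↥b × Fin (dimSU N) => v q.1 q.2) ⬝ᵥ (A *ᵥ fun q => v q.1 q.2))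
    {γ₀ M : ℝ} {d : ℕ} (hd : 1 ≤ d) (hM : 0 < M) (hγ₀ : 0 < γ₀)
    (h19 : ∀ v, Ineq19 (Qf v) (∑ i, ‖v i‖ ^ 2) γ₀ d M)
    (ℓ : BlockChartSU N b →ₗ[ℝ] ℝ) (hlin : ∀ v, lin v = ℓ v)
    (Φ : (↥b × Fin (dimSU N) → ℂ) → ℂ) {r S : ℝ}
    (hVt : ∀ x ∈ K, Vt x = (Φ fun q => ((x q.1 q.2 : ℝ) : ℂ)).re)
    (hΦd : ∀ x ∈ K, DifferentiableOn ℂ Φ (ball (fun q => ((x q.1 q.2 : ℝ) : ℂ)) r))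
    (hΦS : ∀ x ∈ K, ∀ u ∈ ball (fun q : ↥b × Fin (dimSU N) => ((x q.1 q.2 : ℝ) : ℂ)) r, ‖Φ u‖ ≤ S)
    (hdiam : ∀ x ∈ K, ∀ y ∈ K, ‖y - x‖ < r)
    (hclause : 16 * d * (100 * M) ^ (d + 1) * S ≤ γ₀ * r ^ 2) :
    ConvexOn ℝ K φ := by
  refine convexOn_blockChartSU_expansion_of_analyticRemainder b hK φ Qf lin Vt c hexp A hQf hd hM hγ₀ h19 ℓ hlin Φ
    (B := 2 * S) hVt hΦd (fun x hx => ?_) hdiam ?_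
  · have hr : 0 < r := by simpa using hdiam x hx x hx
    exact mapsTo_closedBall_of_norm_le Φ hr (hΦS x hx)
  · calc 8 * (d : ℝ) * (100 * M) ^ (d + 1) * (2 * S) = 16 * d * (100 * M) ^ (d + 1) * S := by ring
      _ ≤ γ₀ * r ^ 2 := hclause

/-- ★★′ (flat frame) **THE SAME FOR FILE 1's ★★ ON `κ → ℝ`**: p606637's `convexOn_expansion_of_analyticRemainder` with the
oscillation letter SUPPLIED by a sup bound `‖Φ u‖ ≤ S` on the `r`-balls (§2b); clause `16·d·(100M)^{d+1}·S ≤ γ₀·r²`.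
[textbook] -/
theorem convexOn_expansion_of_analyticSupBound {κ : Type*} [Fintype κ] {K : Set (κ → ℝ)} (hK : Convex ℝ K)
    (φ Qf lin Vt : (κ → ℝ) → ℝ) (c : ℝ) (hexp : ∀ v ∈ K, φ v = c + 1 / 2 * Qf v + lin v + Vt v)
    (A : Matrix κ κ ℝ) (hQf : ∀ v, Qf v = v ⬝ᵥ (A *ᵥ v))
    {γ₀ M : ℝ} {d : ℕ} (hd : 1 ≤ d) (hM : 0 < M) (hγ₀ : 0 < γ₀)
    (h19 : ∀ v, Ineq19 (Qf v) (∑ b, v b ^ 2) γ₀ d M)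
    (ℓ : (κ → ℝ) →ₗ[ℝ] ℝ) (hlin : ∀ v, lin v = ℓ v)
    (Φ : (κ → ℂ) → ℂ) {r S : ℝ} (hVt : ∀ x ∈ K, Vt x = (Φ fun i => (x i : ℂ)).re)
    (hΦd : ∀ x ∈ K, DifferentiableOn ℂ Φ (ball (fun i => (x i : ℂ)) r))
    (hΦS : ∀ x ∈ K, ∀ u ∈ ball (fun i => (x i : ℂ)) r, ‖Φ u‖ ≤ S)
    (hdiam : ∀ x ∈ K, ∀ y ∈ K, ‖y - x‖ < r)
    (hclause : 16 * d * (100 * M) ^ (d + 1) * S ≤ γ₀ * r ^ 2) :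
    ConvexOn ℝ K φ := by
  refine N21ChartExponentConvexity.convexOn_expansion_of_analyticRemainder hK φ Qf lin Vt c hexp A hQf hd hM hγ₀ h19 ℓ
    hlin Φ (B := 2 * S) hVt hΦd (fun x hx => ?_) hdiam ?_
  · have hr : 0 < r := by simpa using hdiam x hx x hx
    exact mapsTo_closedBall_of_norm_le Φ hr (hΦS x hx)
  · calc 8 * (d : ℝ) * (100 * M) ^ (d + 1) * (2 * S) = 16 * d * (100 * M) ^ (d + 1) * S := by ring
      _ ≤ γ₀ * r ^ 2 := hclause

end AnalyticRemainder

/-! ## §3  ★★★ dag-n21-w1 g2's END on the block chart space with `hφ` DISCHARGED -/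

section End

/-- ★★★ **(M1) ON THE CUT CHART LAW, AT [LF-II] §1's LETTERS, ON `BlockChartSU N b` — CONVEXITY BINDER DISCHARGED.**
dag-n21-w1 g2's ★★★ `slotAntiConcentration_blockChartSU_of_sect1Letters` (p604008) with `hφ : ConvexOn ℝ K φ` REPLACED
by: `Qf v = flat v ⬝ᵥ (A *ᵥ flat v)`, (1.9) for every `v`, `lin = ⇑ℓ`, `Vt = Re Φ∘ι∘flat` with `Φ` complex differentiable
on the `r`-balls about the real points of `K` with oscillation `≤ B`, `diam K < r`, and the clause
`8·d·(100M)^{d+1}·B ≤ γ₀·r²`.  Every other binder verbatim (the clause with `d_N·L²`, `henv`∕`hRT` along `l • z`, the odds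
`hQ`). [textbook] -/
theorem slotAntiConcentration_blockChartSU_of_sect1Letters_convexFree (hN : 2 ≤ N) (b : Finset (PBond P j))
    (hb : b.Nonempty) (K : Set (BlockChartSU N b)) (φ Qf lin Vt : BlockChartSU N b → ℝ)
    (hg : Measurable fun z : BlockChartSU N b => K.indicator (fun w => ENNReal.ofReal (Real.exp (-φ w))) z)
    {U : BlockChartSU N b → ℝ} (hUm : Measurable U)
    {C Env : Set (BlockChartSU N b)} (hC : MeasurableSet C) (hEnv : MeasurableSet Env)
    {θ ρ σ κ₀ Q L γ₀ M B₃ M₀ A₀ p₀g Rk WV : ℝ} {d : ℕ}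
    (hθ : 0 < θ) (hρ0 : 0 < ρ) (hρ1 : ρ < 1) (hρσ : ρ + σ ≤ 1) (hκ : 0 < κ₀) (hQ0 : 0 ≤ Q) (hL : 0 < L)
    (hd : 1 ≤ d) (hM : 0 < M) (hγ₀ : 0 < γ₀)
    (hW : 0 ≤ 3 * B₃ * M₀ * A₀ ^ 2 * p₀g ^ 2 * Real.exp (-Rk) * (100 * M) ^ 4 + WV)
    (hK : Convex ℝ K) (h0K : (0 : BlockChartSU N b) ∈ K)
    (hexp : ∀ v ∈ K, φ v = φ 0 + 1 / 2 * Qf v + lin v + Vt v)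
    (A : Matrix (↥b × Fin (dimSU N)) (↥b × Fin (dimSU N)) ℝ)
    (hQf : ∀ v, Qf v = (fun q : ↥b × Fin (dimSU N) => v q.1 q.2) ⬝ᵥ (A *ᵥ fun q => v q.1 q.2))
    (h19 : ∀ v, Ineq19 (Qf v) (∑ i, ‖v i‖ ^ 2) γ₀ d M)
    (h16 : ∀ v ∈ K, Ineq16 (lin v) B₃ M₀ A₀ p₀g Rk M)
    (ℓ : BlockChartSU N b →ₗ[ℝ] ℝ) (hlin : ∀ v, lin v = ℓ v)
    (hV : ∀ v ∈ K, |Vt v| ≤ WV)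
    (Φ : (↥b × Fin (dimSU N) → ℂ) → ℂ) {r B : ℝ}
    (hVtΦ : ∀ x ∈ K, Vt x = (Φ fun q => ((x q.1 q.2 : ℝ) : ℂ)).re)
    (hΦd : ∀ x ∈ K, DifferentiableOn ℂ Φ (ball (fun q => ((x q.1 q.2 : ℝ) : ℂ)) r))
    (hΦB : ∀ x ∈ K, MapsTo Φ (ball (fun q => ((x q.1 q.2 : ℝ) : ℂ)) r)
      (closedBall (Φ fun q => ((x q.1 q.2 : ℝ) : ℂ)) B))
    (hdiam : ∀ x ∈ K, ∀ y ∈ K, ‖y - x‖ < r)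
    (hconv : 8 * d * (100 * M) ^ (d + 1) * B ≤ γ₀ * r ^ 2)
    (hU : ∀ a a' : BlockChartSU N b, U a - U a' ≤ L * ‖a - a'‖)
    (hUc : U 0 ≤ σ * θ)
    (hclause : 16 * (3 * B₃ * M₀ * A₀ ^ 2 * p₀g ^ 2 * Real.exp (-Rk) * (100 * M) ^ 4 + WV) * d
      * (100 * M) ^ (d + 1) * (dimSU N * L ^ 2) ≤ γ₀ * (θ * (1 - ρ - σ)) ^ 2)
    (henv : ∀ l ∈ Icc (1 - 1 / ((b.card : ℝ) * dimSU N + 1)) 1, ∀ z : BlockChartSU N b,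
      θ * (1 - ρ) ≤ U z → U z < θ → z ∈ C → l • z ∈ Env)
    (hRT : ∀ z : BlockChartSU N b, θ * (1 - ρ) ≤ U z → U z < θ → z ∈ C → ∀ s : ℝ, 1 ≤ s →
      θ * (1 - ρ) ≤ U (s • z) → U (s • z) < θ → s • z ∈ C → U z + κ₀ * (θ * (1 - ρ)) * (s - 1) ≤ U (s • z))
    (hQ : ((volume : Measure (BlockChartSU N b)).withDensity fun z =>
        K.indicator (fun w => ENNReal.ofReal (Real.exp (-φ w))) z) (Env \ ({z | U z < θ} ∩ C))
      ≤ ENNReal.ofReal Q * ((volume : Measure (BlockChartSU N b)).withDensity fun z =>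
        K.indicator (fun w => ENNReal.ofReal (Real.exp (-φ w))) z) ({z | U z < θ} ∩ C)) :
    SlotAntiConcentration
      (((volume : Measure (BlockChartSU N b)).withDensity fun z =>
          K.indicator (fun w => ENNReal.ofReal (Real.exp (-φ w))) z).restrict ({z | U z < θ} ∩ C))
      U θ ρ (3 * ((b.card : ℝ) * dimSU N + 1) * (1 + Q) / (κ₀ * (1 - ρ))) :=
  slotAntiConcentration_blockChartSU_of_sect1Letters hN b hb K φ Qf lin Vt hg hUm hC hEnv hθ hρ0 hρ1 hρσ hκ hQ0 hL hd
    hM hγ₀ hW hK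
    (convexOn_blockChartSU_expansion_of_analyticRemainder b hK φ Qf lin Vt (φ 0) hexp A hQf hd hM hγ₀ h19 ℓ hlin Φ
      hVtΦ hΦd hΦB hdiam hconv)
    h0K hexp (fun v _ => h19 v) h16 hV hU hUc hclause henv hRT hQ

end End

end Summit.QuantumFields.YangMills.Theorems.N21ChartExponentConvexitySUN
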